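import Summits.BirchSwinnertonDyer.BirchSwinnertonDyer.Theorems.InertBadSignedBranchesInertBadAtThreeRangeWitness
import Summits.BirchSwinnertonDyer.BirchSwinnertonDyer.Theorems.BiquadraticEisensteinDescentEisensteinHeartFlatCMInertBadKPrimeRangeRigidity
import Literature.NumberTheory.EllipticCurves.KatzPAdicLFunctionCMField
import HarnessLib

set_option linter.dupNamespace false -- `Summit.BirchSwinnertonDyer.BirchSwinnertonDyer.Theorems.…` (summit = sub, D-0017)
set_option autoImplicit false

/-!
# The Katz line series of the cruxes' input is UNIQUE for its frame — unconditionally, at every odd prime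

Routes `InertBadSignedBranches` / `BiquadraticEisensteinDescent` (cell `pub/bsd-wall`, width seat `bsd-wall-cm-bed-w1` g21). THEOREMS ONLY;
supports, does not close, stmt-BirchSwinnertonDyer-19225 (`InertBadAtThree`) and serves stmt-BirchSwinnertonDyer-21341 identically; no `Theses` import.

The research stubs of both cruxes (`stub_V4Rr` of 21341's skeleton v8.2, `stub_V4RrThree` of 19225's v10 proposal; one odd-prime statement
`V4Rr_odd`) assert the divisibility `∃ m, p^m · Ch · 𝓞⟦T⟧ ⊆ (G)` for EVERY series `G ∈ 𝓞_{ℂ_p}⟦T⟧` taking, at the node `r(γ) − 1` of every point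
`(χ, n, r)` of Hsieh's range, the Katz-normalised value `ι′⁻¹(interpolationValue …(L(0, λ·χ∘N))) · ∏_w Ω′_{p,w}^{1+2κ_w}`. The lead's RANGE RIGIDITY
(`…RangeRigidity.eq_of_hasValueAt_range`, p720278) shows such a `G` is unique GIVEN a non-torsion range point; this seat's RANGE WITNESS
(`…RangeWitness.exists_rangeWitness_of_ne_two`, p721552) supplies that point at every odd prime. This file composes the two:

* `eq_of_hasValueAt_range_of_ne_two` — frame-abstracted uniqueness with NO witness hypothesis: `K` imaginary quadratic, `p ≠ 2`, `κ` anticyclotomic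
  with topological generator `γ`, values `val χ n` depending only on `(χ, n)`; two series with these values on the range are equal;
* `katzLineSeries_unique_of_ne_two` — the CONCRETE clause of the stubs: for any frame `(L, Σ_p, S, T, λ, ϑ, C_K, Ω, Ω′_p, w₁)` whose twisted
  `L`-functions `L(s, λ·χ∘N_{L/K})` continue (the stubs' hypothesis `hcont`), two series `G, G′` satisfying the stubs' value clause VERBATIM are equal.
  (The clause quantifies over the continuation proof `hL`; the value is read at the frame's own continuation, all such proofs being equal.)

So the `∀ G` of `stub_V4Rr` / `stub_V4RrThree` / `V4Rr_odd` ranges over AT MOST ONE series per frame, unconditionally. HONEST STATUS: kernel glue of two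
landed theorems; the divisibility itself (NOT in print) is untouched; BSD is not proved by any of this; 19225 / 21341 stay OPEN.
References: [Gouvea1993PadicNumbers] §5.6 Cor. 5.6.4 (identity principle); [deShalit1987] II.4.17; [Hsieh2014Crelle] Prop. 4.9; [Washington1997] §13.1.
-/

noncomputable section

open scoped Classical NumberField
open NumberField IsDedekindDomain Field
  Literature.NumberTheory.GaloisRepresentations Literature.NumberTheory.EllipticCurves

namespace Summit.BirchSwinnertonDyer.BirchSwinnertonDyer.Theorems.InertBadSignedBranchesInertBadAtThreeRangeUniqueness

open Summit.BirchSwinnertonDyer.BirchSwinnertonDyer.Theorems.InertBadSignedBranchesInertBadAtThreeRangeWitness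
  (exists_rangeWitness_of_ne_two)
open Summit.BirchSwinnertonDyer.BirchSwinnertonDyer.Theorems.BiquadraticEisensteinDescentEisensteinHeartFlatCMInertBadKPrimeRangeRigidity
  (eq_of_hasValueAt_range)

/-- **Range rigidity without a witness hypothesis (every odd prime).** For `K` imaginary quadratic, `p ≠ 2`, `κ` an anticyclotomic
`ℤ_p`-extension with topological generator `γ`, `ι : ℚ̄_p ≃ ℂ` and values `val χ n ∈ ℂ_p`: if `G` and `G′` both take the value `val χ n` at the
node `r(γ) − 1` of EVERY point `(χ, n, r)` of Hsieh's range (χ everywhere unramified of type `(n, −n)`, `n > 0`, `r` a `p`-adic avatar of `χ`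
through `κ`), then `G = G′`. = `…RangeRigidity.eq_of_hasValueAt_range` with its non-torsion range point supplied by
`…RangeWitness.exists_rangeWitness_of_ne_two`. [cite: Gouvea1993PadicNumbers, §5.6 Cor. 5.6.4] [cite: deShalit1987, II.4.17] -/
theorem eq_of_hasValueAt_range_of_ne_two (K : Type) [Field K] [NumberField K] (p : ℕ) [Fact p.Prime]
    (hK : IsImaginaryQuadratic K) (hp : p ≠ 2)
    (κ : ZpExtension K p) (hκ : κ.IsAnticyclotomic) {γ : Field.absoluteGaloisGroup K} (hγ : κ.IsTopGenerator γ)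
    (ι : PadicAlgCl p ≃+* ℂ) (val : HeckeCharacter K → ℕ → ℂ_[p]) {G G' : PowerSeries (PadicComplexInt p)}
    (hG : ∀ (χ : HeckeCharacter K) (n : ℕ), 0 < n → (∀ v : HeightOneSpectrum (𝓞 K), χ.IsUnramifiedAt v) →
      χ.HasInfinityType (fun _ ↦ (n : ℤ)) (fun _ ↦ -(n : ℤ)) →
      ∀ r : FramedGaloisRep K (PadicAlgCl p) 1, IsPAdicAvatarOf ι χ r → FactorsThroughZp κ r →
        IntSeries.HasValueAt G (avatarValueAt r γ - 1) (val χ n))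
    (hG' : ∀ (χ : HeckeCharacter K) (n : ℕ), 0 < n → (∀ v : HeightOneSpectrum (𝓞 K), χ.IsUnramifiedAt v) →
      χ.HasInfinityType (fun _ ↦ (n : ℤ)) (fun _ ↦ -(n : ℤ)) →
      ∀ r : FramedGaloisRep K (PadicAlgCl p) 1, IsPAdicAvatarOf ι χ r → FactorsThroughZp κ r →
        IntSeries.HasValueAt G' (avatarValueAt r γ - 1) (val χ n)) :
    G = G' :=
  eq_of_hasValueAt_range κ hγ ι val hG hG' (exists_rangeWitness_of_ne_two K p hK hp κ hκ γ hγ ι)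

/-- **The Katz line series of the stubs' frame is unique (every odd prime, no witness hypothesis).** For `K` imaginary quadratic, `p ≠ 2`,
`κ` anticyclotomic with topological generator `γ` (bound by `Fact`, as in the registered texts), `ι′`, and ANY frame
`(L, Σ_p, S, T, λ, ϑ, C_K, Ω, Ω′_p, w₁)` whose twisted Hecke `L`-functions `L(s, λ · χ∘N_{L/K})` continue for range characters `χ` (the stubs'
hypothesis `hcont`): two series `G, G′ ∈ 𝓞_{ℂ_p}⟦T⟧` satisfying the VALUE CLAUSE of `stub_V4Rr` / `stub_V4RrThree` / `V4Rr_odd` verbatim —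
`G(r(γ) − 1) = ι′⁻¹(interpolationValue ι′ Σ_p S T λ (χ∘N) 1 κ_n ϑ C_K Ω (L(0))) · ∏_w Ω′_{p,w}^{1 + 2 κ_n(w)}` at every range point, `κ_n(w₁) = n`,
`κ_n(w) = n − 1` otherwise — are EQUAL. So the `∀ G` of those stubs concerns at most one series per frame.
[cite: Gouvea1993PadicNumbers, §5.6 Cor. 5.6.4] [cite: Hsieh2014mu, Prop. 4.9 (§4.8)] -/
theorem katzLineSeries_unique_of_ne_two (K : Type) [Field K] [NumberField K] (p : ℕ) [Fact p.Prime]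
    (hK : IsImaginaryQuadratic K) (hp : p ≠ 2)
    (κ : ZpExtension K p) (hκ : κ.IsAnticyclotomic) (γ : Field.absoluteGaloisGroup K) [Fact (κ.IsTopGenerator γ)]
    (ι' : PadicAlgCl p ≃+* ℂ)
    (L : Type) [Field L] [NumberField L] [Algebra K L] [IsGalois K L]
    (Sp S T : Finset (HeightOneSpectrum (𝓞 L))) (lam : HeckeCharacter L) (ϑ : L) (CK : ℂ)
    (Ω : InfinitePlace L → ℂ) (ΩpK : InfinitePlace L → ℂ_[p]) (w₁ : InfinitePlace L)
    (hcont : ∀ (χ : HeckeCharacter K) (n : ℕ), 0 < n → (∀ v : HeightOneSpectrum (𝓞 K), χ.IsUnramifiedAt v) →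
      χ.HasInfinityType (fun _ ↦ (n : ℤ)) (fun _ ↦ -(n : ℤ)) →
      LFunction.HasEntireContinuation (heckeLFunction (lam * χ.compRelNorm L)))
    {G G' : PowerSeries 𝓞_ℂ_[p]}
    (hG : ∀ (χ : HeckeCharacter K) (n : ℕ), 0 < n → (∀ v : HeightOneSpectrum (𝓞 K), χ.IsUnramifiedAt v) →
      χ.HasInfinityType (fun _ ↦ (n : ℤ)) (fun _ ↦ -(n : ℤ)) →
      ∀ r : FramedGaloisRep K (PadicAlgCl p) 1, IsPAdicAvatarOf ι' χ r → FactorsThroughZp κ r →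
      ∀ hL : LFunction.HasEntireContinuation (heckeLFunction (lam * χ.compRelNorm L)),
        IntSeries.HasValueAt G (avatarValueAt r γ - 1)
          ((((ι'.symm (KatzCM.interpolationValue ι' Sp S T lam (χ.compRelNorm L) 1
              (fun w ↦ if w = w₁ then n else n - 1) ϑ CK Ω (hL.continuation 0))) : PadicAlgCl p) : ℂ_[p]) *
            ∏ w, ΩpK w ^ (1 + 2 * (fun w ↦ if w = w₁ then n else n - 1) w)))
    (hG' : ∀ (χ : HeckeCharacter K) (n : ℕ), 0 < n → (∀ v : HeightOneSpectrum (𝓞 K), χ.IsUnramifiedAt v) →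
      χ.HasInfinityType (fun _ ↦ (n : ℤ)) (fun _ ↦ -(n : ℤ)) →
      ∀ r : FramedGaloisRep K (PadicAlgCl p) 1, IsPAdicAvatarOf ι' χ r → FactorsThroughZp κ r →
      ∀ hL : LFunction.HasEntireContinuation (heckeLFunction (lam * χ.compRelNorm L)),
        IntSeries.HasValueAt G' (avatarValueAt r γ - 1)
          ((((ι'.symm (KatzCM.interpolationValue ι' Sp S T lam (χ.compRelNorm L) 1
              (fun w ↦ if w = w₁ then n else n - 1) ϑ CK Ω (hL.continuation 0))) : PadicAlgCl p) : ℂ_[p]) *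
            ∏ w, ΩpK w ^ (1 + 2 * (fun w ↦ if w = w₁ then n else n - 1) w))) :
    G = G' := by
  -- the value at `(χ, n)`, read at the frame's own continuation proof (zero off the range — never used there)
  refine eq_of_hasValueAt_range_of_ne_two K p hK hp κ hκ (γ := γ) Fact.out ι'
    (fun χ n ↦ if h : 0 < n ∧ (∀ v : HeightOneSpectrum (𝓞 K), χ.IsUnramifiedAt v) ∧
        χ.HasInfinityType (fun _ ↦ (n : ℤ)) (fun _ ↦ -(n : ℤ)) then
      ((((ι'.symm (KatzCM.interpolationValue ι' Sp S T lam (χ.compRelNorm L) 1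
          (fun w ↦ if w = w₁ then n else n - 1) ϑ CK Ω ((hcont χ n h.1 h.2.1 h.2.2).continuation 0))) : PadicAlgCl p) : ℂ_[p]) *
        ∏ w, ΩpK w ^ (1 + 2 * (fun w ↦ if w = w₁ then n else n - 1) w))
      else 0) ?_ ?_
  · intro χ n hn hu ht r hav hfac
    have h := hG χ n hn hu ht r hav hfac (hcont χ n hn hu ht)
    simp only [dif_pos (show 0 < n ∧ (∀ v : HeightOneSpectrum (𝓞 K), χ.IsUnramifiedAt v) ∧
      χ.HasInfinityType (fun _ ↦ (n : ℤ)) (fun _ ↦ -(n : ℤ)) from ⟨hn, hu, ht⟩)]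
    exact h
  · intro χ n hn hu ht r hav hfac
    have h := hG' χ n hn hu ht r hav hfac (hcont χ n hn hu ht)
    simp only [dif_pos (show 0 < n ∧ (∀ v : HeightOneSpectrum (𝓞 K), χ.IsUnramifiedAt v) ∧
      χ.HasInfinityType (fun _ ↦ (n : ℤ)) (fun _ ↦ -(n : ℤ)) from ⟨hn, hu, ht⟩)]
    exact h

end Summit.BirchSwinnertonDyer.BirchSwinnertonDyer.Theorems.InertBadSignedBranchesInertBadAtThreeRangeUniqueness

end
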